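import Summits.Ventures.DiscreteObjects.UnitDistance.MoserFieldF4
import HarnessLib

/-!
# The VND base ring `ℤ[1/3][ζ₂₄]` reduces onto `F₄`: every unit-distance graph built from it is 4-colourable

Framing (verbatim for the cell): lottery ticket; floor = certified bounds/negative ranges.

Census file of the (U) seat (pub-namedobj-udg-g3; TABLE-U3 §6, PROP-U2.md, Theorem U4 `χ(ℚ(√2,√3)²) = 4`).  The base sets
`M₁ ⊂ M₂ ⊂ M₃ ⊂ …` of Voronov–Neopryatnaya–Dergachev's "series 2" (Discrete Math. 345 (2022) 113106, §6) are generated, as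
complex numbers, by `φ₀ = ζ₂₄ = e^{iπ/12}` and `φ₁ = (√6 + i√3)/3 = (ζ₂₄¹⁹ − ζ₂₄¹⁶ − ζ₂₄¹³ − ζ₂₄¹¹ + ζ₂₄⁸ + ζ₂₄⁵)/3`; all of
them, and all Minkowski sums / unions with rotations by elements of this ring, carry labels in
`B = ℤ[1/3][ζ₂₄] = ℤ[x₀, x₁]/(x₀⁸ − x₀⁴ + 1, 3x₁ − 1)` (`x₀ = ζ₂₄`, `x₁ = 1/3`), a subring of `ℚ(√2,√3,i) ⊃ ℚ(√2,√3)²`.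
Complex conjugation acts by `σ(x₀) = x₀⁻¹ = −x₀¹¹`, `σ(x₁) = x₁`; two labelled points are at Euclidean distance `1` iff
`u = z − w` satisfies `u·σ(u) = 1`.  Reduction modulo the prime of `ℚ(√2,√3,i)` above `2` is `ρ : B →+* F₄`, `x₀ ↦ ω`,
`x₁ ↦ 1` (cell PROP-U2 (d), inert case `[3] = [−5]`).  THEOREM `colorable_four_of_vndRing`: any graph with `B`-labels and
`u·σ(u) = 1` along every edge is 4-colourable.  This is the machine-checked core of the census facts 'χ(M₂) = χ(M₃) = 4'
(job j096420) and of the 37/37 solver-free 4-colourings of the in-field unions `M₃ ∪ ψM₃` (TABLE-U3 §6) — for those `ψ`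
that lie in `B`; the passage to all of `ℚ(√2,√3)²` is PROP-U2's valuation argument (paper).  `F₄`, `ω` and the counting
lemma are imported from `MoserFieldF4.lean`.  Nothing here is literature.
-/

noncomputable section

namespace Summit.Ventures.DiscreteObjects.UnitDistance

open Polynomial SimpleGraph MvPolynomial

/-! ### The ring `B = ℤ[x₀, x₁]/(Φ₂₄(x₀), 3x₁ − 1)` -/

/-- The two defining relations: the 24th cyclotomic polynomial `x₀⁸ − x₀⁴ + 1` and `3x₁ − 1`. -/
def vndRel : Fin 2 → MvPolynomial (Fin 2) ℤ
  | 0 => X 0 ^ 8 - X 0 ^ 4 + 1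
  | 1 => MvPolynomial.C 3 * X 1 - 1

/-- The ideal of relations. -/
def vndIdeal : Ideal (MvPolynomial (Fin 2) ℤ) := Ideal.span (Set.range vndRel)

/-- The VND base ring `B = ℤ[1/3][ζ₂₄]` by generators and relations. -/
abbrev VNDRing : Type := MvPolynomial (Fin 2) ℤ ⧸ vndIdeal

/-- The class of the generator `xᵢ` in `B` (`x₀ = ζ₂₄`, `x₁ = 1/3`). -/
def vgen (i : Fin 2) : VNDRing := Ideal.Quotient.mk vndIdeal (X i)

/-- Each defining relation vanishes in `B`. -/
theorem vndRel_mk_eq_zero (i : Fin 2) : Ideal.Quotient.mk vndIdeal (vndRel i) = 0 :=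
  Ideal.Quotient.eq_zero_iff_mem.2 (Ideal.subset_span ⟨i, rfl⟩)

/-- `Φ₂₄(ζ₂₄) = ζ₂₄⁸ − ζ₂₄⁴ + 1 = 0` in `B`. -/
theorem vgen0_rel : vgen 0 ^ 8 - vgen 0 ^ 4 + 1 = 0 := by
  have h := vndRel_mk_eq_zero 0
  simpa [vndRel, vgen, map_sub, map_add, map_pow, map_one] using h

/-- `3·(1/3) − 1 = 0` in `B`. -/
theorem vgen1_rel : 3 * vgen 1 - 1 = 0 := by
  have h := vndRel_mk_eq_zero 1
  simpa [vndRel, vgen, map_sub, map_mul, map_one, map_ofNat] using h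

/-- `ζ₂₄¹² = −1` in `B` (since `x¹² + 1 = (x⁴ + 1)·Φ₂₄(x)`). -/
theorem vgen0_pow_twelve : vgen 0 ^ 12 = -1 := by
  linear_combination (vgen 0 ^ 4 + 1) * vgen0_rel

/-! ### Reduction `ρ : B →+* F₄` (`ζ₂₄ ↦ ω`, `1/3 ↦ 1`) -/

/-- Images of the generators in `F₄`. -/
def vndGensF4 : Fin 2 → F4 := ![omegaF4, 1]

/-- The relations hold in `F₄` under `ζ₂₄ ↦ ω`, `1/3 ↦ 1`: `Φ₂₄(ω) = ω² − ω + 1 = (ω² + ω + 1) − 2ω = 0` and `3 − 1 = 2 = 0`. -/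
theorem eval_vndRel_F4 (i : Fin 2) : eval₂Hom (Int.castRingHom F4) vndGensF4 (vndRel i) = 0 := by
  fin_cases i
  · simp [vndRel, vndGensF4]
    linear_combination (omegaF4 ^ 6 - omegaF4 ^ 5 + omegaF4 ^ 3 - 2 * omegaF4 ^ 2 + omegaF4 + 1) * omegaF4_rel
      - omegaF4 * two_eq_zero_F4
  · simp [vndRel, vndGensF4]
    linear_combination two_eq_zero_F4

/-- `ρ`: reduction of `B` modulo the prime above 2. -/
def vndToF4 : VNDRing →+* F4 :=
  Ideal.Quotient.lift vndIdeal (eval₂Hom (Int.castRingHom F4) vndGensF4) (by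
    intro a ha
    refine (Ideal.span_le (I := RingHom.ker (eval₂Hom (Int.castRingHom F4) vndGensF4))).2 ?_ ha
    rintro _ ⟨i, rfl⟩
    exact eval_vndRel_F4 i)

/-! ### Complex conjugation `σ : B →+* B` (`ζ₂₄ ↦ ζ₂₄⁻¹ = −ζ₂₄¹¹`, `1/3 ↦ 1/3`) -/

/-- Images of the generators under conjugation. -/
def vndGensConj : Fin 2 → VNDRing := ![-(vgen 0 ^ 11), vgen 1]

/-- The relations are preserved by `ζ₂₄ ↦ −ζ₂₄¹¹`, `1/3 ↦ 1/3` (`Φ₂₄(−x¹¹) = x⁸⁸ − x⁴⁴ + 1` is a multiple of `Φ₂₄(x)`). -/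
theorem eval_vndRel_conj (i : Fin 2) :
    eval₂Hom ((Ideal.Quotient.mk vndIdeal).comp MvPolynomial.C) vndGensConj (vndRel i) = 0 := by
  fin_cases i
  · simp [vndRel, vndGensConj]
    linear_combination (vgen 0 ^ 80 + vgen 0 ^ 76 - vgen 0 ^ 68 - vgen 0 ^ 64 + vgen 0 ^ 56 + vgen 0 ^ 52 - vgen 0 ^ 44
      - vgen 0 ^ 40 - vgen 0 ^ 36 + vgen 0 ^ 28 + vgen 0 ^ 24 - vgen 0 ^ 16 - vgen 0 ^ 12 + vgen 0 ^ 4 + 1) * vgen0_rel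
  · simp [vndRel, vndGensConj]
    linear_combination vgen1_rel

/-- `σ`: the involution of `B` induced by complex conjugation. -/
def vndConj : VNDRing →+* VNDRing :=
  Ideal.Quotient.lift vndIdeal (eval₂Hom ((Ideal.Quotient.mk vndIdeal).comp MvPolynomial.C) vndGensConj) (by
    intro a ha
    refine (Ideal.span_le (I := RingHom.ker (eval₂Hom ((Ideal.Quotient.mk vndIdeal).comp MvPolynomial.C) vndGensConj))).2 ?_ ha
    rintro _ ⟨i, rfl⟩
    exact eval_vndRel_conj i)

/-- `σ(ζ₂₄) = −ζ₂₄¹¹`. -/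
theorem vndConj_vgen0 : vndConj (vgen 0) = -(vgen 0 ^ 11) := by
  simp [vndConj, vgen, vndGensConj]

/-- The generator `φ₀ = ζ₂₄` is a "unit vector": `φ₀·σ(φ₀) = −ζ₂₄¹² = 1`. -/
theorem vgen0_mul_conj : vgen 0 * vndConj (vgen 0) = 1 := by
  rw [vndConj_vgen0]
  linear_combination (-(vgen 0 ^ 4) - 1) * vgen0_rel

/-! ### The theorem -/

/-- KEY STEP: if `u·σ(u) = 1` in `B` then `ρ(u) ≠ 0` in `F₄`. -/
theorem vndToF4_ne_zero_of_mul_conj {u : VNDRing} (hu : u * vndConj u = 1) : vndToF4 u ≠ 0 := by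
  intro h0
  have h := congrArg vndToF4 hu
  rw [map_mul, map_one, h0, zero_mul] at h
  exact zero_ne_one h

/-- MAIN THEOREM (machine-checked core of `χ(ℚ(√2,√3)²) ≤ 4` for ring-labelled graphs): let the vertices of `G` carry
labels `p v ∈ B = ℤ[1/3][ζ₂₄]` such that along every edge `u = p v − p w` satisfies `u·σ(u) = 1`. Then `G` is 4-colourable
(`v ↦ ρ(p v) ∈ F₄` is proper).  Covers every VND series-2 base set `M_s(t)` and its unions with `B`-rotations. -/
theorem colorable_four_of_vndRing {V : Type*} {G : SimpleGraph V} (p : V → VNDRing)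
    (hadj : ∀ ⦃v w : V⦄, G.Adj v w → (p v - p w) * vndConj (p v - p w) = 1) : G.Colorable 4 := by
  classical
  have C : G.Coloring F4 := Coloring.mk (fun v => vndToF4 (p v)) (by
    intro v w hvw heq
    have hne := vndToF4_ne_zero_of_mul_conj (hadj hvw)
    apply hne
    rw [map_sub, sub_eq_zero]
    exact heq)
  exact (C.colorable).mono F4.card_le_four

end Summit.Ventures.DiscreteObjects.UnitDistance

end
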